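import Mathlib
import Literature.Analysis.FluidPDE.Tao2016AveragedNS.ShiftSetCascadeFlows
import Summits.NavierStokesRegularity.NavierStokesRegularity.Theorems.TaoLadderRungTwoFlatCertificateGlueLohnerDenseOn
import HarnessLib

/-!
# Certificate glue on a shift set `𝕊`, XXV-b: THE CHECKER'S SCALAR CLAUSES — exact rational tests of the E-recursion (C8),
  the majorant guard and the region radius (C9) of the Lohner step, with their soundness over `ℝ`
  (helper for items stmt-NavierStokesRegularity-22987 `FlatGapCertificatesV2` (crux K_A♭ of route TaoLadderRungTwoFlat) and
  stmt-24295 K_A₂(64); cell harvest/h2-tao-ladder, p1 g15; CHECKER-SPEC-v3 §3 (ii) clauses C8/C9)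

The scalar clauses of `LandingClausesAt` / `stepCert_of_plohner_dense` (glue XIX-e) — the E-recursion
`κI + dP + NVh·E₀ + Rem + ρ·RemV + Dev ≤ E₁`, the guard `b(mC+ρ)h < 1` and the region `R_h + A' ≤ R` — involve a handful of
numbers per step; they are tested in EXACT rational arithmetic (`decide` on `ℚ`), and transported to `ℝ` by cast monotonicity.
`remQ` / `remVQ` / `devQ` / `eRecQ` are the rational twins of the three Cauchy-majorant remainders and of the left side of C8
(same closed forms as glue XVIII / pub-ns-dss's `RemK` / `RemVK` / `DevK`).

HONEST FRAMING: Tao-type MODEL lattices (Tao 2016 §4/§6 vocabulary, shift-set parametrised); arithmetic soundness lemmas — no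
certificate data, nothing certified, no stub closed, nothing about the Navier–Stokes equations.
-/

-- the sub-problem namespace repeats the summit name by design (D-0017)
set_option linter.dupNamespace false

namespace Summit.NavierStokesRegularity.NavierStokesRegularity.Theorems

namespace CertificateGlueOn

/-- Rational twin of the centre remainder `Rem = mC (b mC h)^{p+1} / (1 − b mC h)`. [folklore] -/
def remQ (p : ℕ) (b mC h : ℚ) : ℚ := mC * (b * mC * h) ^ (p + 1) / (1 - b * mC * h)

/-- Rational twin of the variational remainder `RemV = ((p+2)(b mC h)^{p+1} − (p+1)(b mC h)^{p+2}) / (1 − b mC h)²`. [folklore] -/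
def remVQ (p : ℕ) (b mC h : ℚ) : ℚ :=
  ((((p : ℚ) + 2) * (b * mC * h) ^ (p + 1) - ((p : ℚ) + 1) * (b * mC * h) ^ (p + 2)) / (1 - b * mC * h) ^ 2)

/-- Rational twin of the second-order deviation `Dev = (mC+ρ)/(1−b(mC+ρ)h) − mC/(1−b mC h) − ρ/(1−b mC h)²`. [folklore] -/
def devQ (b mC ρ h : ℚ) : ℚ :=
  (mC + ρ) / (1 - b * (mC + ρ) * h) - mC / (1 - b * mC * h) - ρ / (1 - b * mC * h) ^ 2

/-- Rational twin of the left side of the E-recursion (C8). [folklore] -/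
def eRecQ (p : ℕ) (b mC ρC E₀ κI dP NVh h : ℚ) : ℚ :=
  κI + dP + NVh * E₀ + remQ p b mC h + (ρC + E₀) * remVQ p b mC h + devQ b mC (ρC + E₀) h

/-- **The C8 test**: `eRecQ ≤ E₁` in exact rational arithmetic. [folklore] -/
def checkERec (p : ℕ) (b mC ρC E₀ κI dP NVh h E₁ : ℚ) : Bool := decide (eRecQ p b mC ρC E₀ κI dP NVh h ≤ E₁)

/-- **C8 FROM THE TEST**: the real E-recursion inequality of `LandingClausesAt` / glue XVIII for the cast data. [folklore] -/
theorem eRec_of_check {p : ℕ} {b mC ρC E₀ κI dP NVh h E₁ : ℚ} (hc : checkERec p b mC ρC E₀ κI dP NVh h E₁ = true) :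
    (κI : ℝ) + dP + NVh * E₀ + mC * ((b : ℝ) * mC * h) ^ (p + 1) / (1 - (b : ℝ) * mC * h) +
      ((ρC : ℝ) + E₀) * ((((p : ℝ) + 2) * ((b : ℝ) * mC * h) ^ (p + 1) - ((p : ℝ) + 1) * ((b : ℝ) * mC * h) ^ (p + 2)) /
        (1 - (b : ℝ) * mC * h) ^ 2) +
      (((mC : ℝ) + (ρC + E₀)) / (1 - (b : ℝ) * (mC + (ρC + E₀)) * h) - (mC : ℝ) / (1 - (b : ℝ) * mC * h) -
        ((ρC : ℝ) + E₀) / (1 - (b : ℝ) * mC * h) ^ 2) ≤ (E₁ : ℝ) := by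
  have h1 : (eRecQ p b mC ρC E₀ κI dP NVh h : ℝ) ≤ (E₁ : ℝ) := by exact_mod_cast of_decide_eq_true hc
  have h2 : (eRecQ p b mC ρC E₀ κI dP NVh h : ℝ) =
      (κI : ℝ) + dP + NVh * E₀ + mC * ((b : ℝ) * mC * h) ^ (p + 1) / (1 - (b : ℝ) * mC * h) +
      ((ρC : ℝ) + E₀) * ((((p : ℝ) + 2) * ((b : ℝ) * mC * h) ^ (p + 1) - ((p : ℝ) + 1) * ((b : ℝ) * mC * h) ^ (p + 2)) /
        (1 - (b : ℝ) * mC * h) ^ 2) +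
      (((mC : ℝ) + (ρC + E₀)) / (1 - (b : ℝ) * (mC + (ρC + E₀)) * h) - (mC : ℝ) / (1 - (b : ℝ) * mC * h) -
        ((ρC : ℝ) + E₀) / (1 - (b : ℝ) * mC * h) ^ 2) := by
    simp only [eRecQ, remQ, remVQ, devQ]
    push_cast
    ring
  linarith [h1, h2.symm.le, h2.le]

/-- **The C9 guard test**: `0 ≤ h` and `b (mC + ρC + E₀) h < 1` exactly. [folklore] -/
def checkGuard (b mC ρC E₀ h : ℚ) : Bool := decide (0 ≤ h) && decide (b * (mC + (ρC + E₀)) * h < 1)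

/-- C9 guard from the test. [folklore] -/
theorem guard_of_check {b mC ρC E₀ h : ℚ} (hc : checkGuard b mC ρC E₀ h = true) :
    (0 : ℝ) ≤ (h : ℝ) ∧ (b : ℝ) * ((mC : ℝ) + ((ρC : ℝ) + (E₀ : ℝ))) * (h : ℝ) < 1 := by
  simp only [checkGuard, Bool.and_eq_true, decide_eq_true_eq] at hc
  obtain ⟨h1, h2⟩ := hc
  refine ⟨by exact_mod_cast h1, ?_⟩
  have : ((b * (mC + (ρC + E₀)) * h : ℚ) : ℝ) < 1 := by exact_mod_cast h2
  push_cast at this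
  exact this

/-- **The C9 region test** (bootstrap form of glue XIX-d, XIX-e): `R_h + A' ≤ R` exactly, `R_h = (mC+ρ)/(1−b(mC+ρ)h)`. [folklore] -/
def checkRegion (b mC ρC E₀ h A' R : ℚ) : Bool :=
  decide ((mC + (ρC + E₀)) / (1 - b * (mC + (ρC + E₀)) * h) + A' ≤ R)

/-- C9 region from the test. [folklore] -/
theorem region_of_check {b mC ρC E₀ h A' R : ℚ} (hc : checkRegion b mC ρC E₀ h A' R = true) :
    ((mC : ℝ) + ((ρC : ℝ) + (E₀ : ℝ))) / (1 - (b : ℝ) * ((mC : ℝ) + ((ρC : ℝ) + (E₀ : ℝ))) * (h : ℝ)) + (A' : ℝ) ≤ (R : ℝ) := by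
  have : (((mC + (ρC + E₀)) / (1 - b * (mC + (ρC + E₀)) * h) + A' : ℚ) : ℝ) ≤ (R : ℝ) := by
    exact_mod_cast of_decide_eq_true hc
  push_cast at this
  exact this

end CertificateGlueOn

end Summit.NavierStokesRegularity.NavierStokesRegularity.Theorems
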